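/-
Copyright (c) 2026 the pub-hodgecm-mathlib formalisation cell (harness21).  Prover seat hodgecm-mathlib-K2E5-p17 (g8), Track B «K2-LIT»,
#184♮ = hLiu418 = `stmt-HodgeConjecture-24832`; socket #41 — THE TOP, edition 4a′ «KIND 0, payers' currency»: O41.4's finiteness DISCHARGED on a compactly supported weight,
the big-cell ∕ middle-cell packages taken UNNORMALISED (author of record, LEAD F0P6-plan (g14) BATCH #46 (a), surface (u-0b) of my 15:37:29Z map).
THEOREMS ONLY (no `def`, no `instance`, no notation, no named-fact hypothesis, no `sorry`); NO `Lines` import.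
-/
import Summits.HodgeConjecture.HodgeConjecture.Theorems.K2LiuSiegelEisensteinConstantTermPackage   -- ★ edition 4a (this seat)
import Summits.HodgeConjecture.HodgeConjecture.Theorems.K2LiuSiegelEisensteinMajorantCompact       -- ★ G1-END `exists_summable_majorant_on_compact'`
import HarnessLib

/-!
# Crux `HLiu418`, socket #41 — THE TOP, edition 4a′: O41.4's FINITENESS `∫⁻ (Σ'_q ‖f_s(γ_q u h)‖ₑ)·β dνN < ∞` FOR A COMPACTLY SUPPORTED COVERING WEIGHT,
# and the KIND-0 package in the payers' UNNORMALISED currency (`E₈ = ∏·M(s)f_s`, `E₇ = ∏·∫β•Σ_REST`)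

Cell `hodgecm-mathlib`, crux item hLiu418 = `stmt-HodgeConjecture-24832` (helper lane until the typist's tie; count-neutral).

★ edition 4a `exists_constantTerm_package` takes O41.4's analytic binder `hH` and the big∕middle packages normalised by `(∫β)⁻¹`.  THIS FILE removes both frictions:
* §1 **`lintegral_tsum_enorm_mul_weight_ne_top`** — for `χ` unitary, `n∕2 < re s`, a continuous Siegel section `f_s`, ANY measure `νN` and a weight `β ≤ 𝟙_K` with `K ⊆ N_Δ(𝔸)` compact and
  `∫⁻ β dνN < ∞` (exactly what ★ `exists_isCoveringWeight_unipDeltaRat_lintegral_ne_top` delivers on ★ (C0)'s cover): `∫⁻ (Σ'_q ‖f_s(γ_q·u·h)‖ₑ)·β(u) dνN(u) ≠ ∞` — the series is bounded on the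
  compact `K·h` by ★ G1-END `exists_summable_majorant_on_compact'`, and `β` kills the rest.  So ed. 4a's `hH` is PAID for every tie-time carrier.
* §2 **`exists_constantTerm_package_of_cells`** — ed. 4a with (a) `hH` discharged by §1 (carrier binders `+ (K) (hK) (hβK : β ≤ 𝟙_K)`, `χ` unitary), (b) the big-cell package in K2Liu-p13's
  currency `E₈ s h = (∏_{p∈P}(s−p))·intertwiningDelta νN (f s) h` (★∕📤 `exists_bigCell_termPackage` (iv)) and the middle package with `E₇ s h = (∏(s−p))·∫β•Σ_REST f_s(γ_q(uh)) dνN`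
  (★ G5-a's `MID` un-normalised) — rescaled inside by `(∫β)⁻¹` (`smul_package`); OUTPUT = the five KIND-0 binders of ★ edition 3b VERBATIM.
Sources: [MoeglinWaldspurger1995, II.1.5, II.1.7, IV.1.8]; [Tan1999, §4 Prop. 4.1]; [Garrett2018, §3.10]; [KudlaRallis1994, §1].
HONEST LABEL.  Count-neutral helper until tied; `HC_CM` is proved only modulo the 7 printed citations (2 remaining named inputs: hLiu418 = `stmt-HodgeConjecture-24832`,
h413 = `stmt-HodgeConjecture-24833`) until rung 0 closes.
-/

set_option autoImplicit false
set_option linter.dupNamespace false -- the mandated namespace repeats `HodgeConjecture.HodgeConjecture`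

noncomputable section

open scoped Matrix Topology ENNReal NNReal BigOperators
open NumberField IsDedekindDomain MeasureTheory Filter
open Literature.NumberTheory.Automorphic Literature.NumberTheory.GaloisRepresentations
open Literature.NumberTheory.GelbartRogawski1991 Literature.NumberTheory.GelbartRogawski1991.GRConstruction
open Literature.NumberTheory.K2Lit.SiegelDoubled Literature.MeasureTheory.Group

namespace Summit.HodgeConjecture.HodgeConjecture.Cruxes.HLiu418.K2LiuSiegelEisensteinConstantTermFiniteness

open K2LiuSiegelUnipotentFourierDefs K2LiuSiegelEisensteinMajorantCompact K2LiuSiegelEisensteinConstantTermPackage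

variable (L : Type) [Field L] [NumberField L] [IsCMField L] {N M n : ℕ} (e : Fin N × Fin M ≃ Fin n)
  (dV : Fin N → L) (hdV : ∀ i, IsCMField.complexConj L (dV i) = dV i)
  (dW : Fin M → L) (hdW : ∀ i, IsCMField.complexConj L (dW i) = dW i)
variable [MeasurableSpace (unipDelta L e dV hdV dW hdW)] [BorelSpace (unipDelta L e dV hdV dW hdW)]

/-! ## §1 O41.4's finiteness on a compactly supported weight -/

section Finiteness

omit [BorelSpace (unipDelta L e dV hdV dW hdW)] in
/-- **O41.4's ANALYTIC BINDER, PAID**: `χ` unitary, `n∕2 < re s`, `f ∈ I_Δ(s,χ)` continuous; a weight `β ≤ 𝟙_K` (`K ⊆ N_Δ(𝔸)` compact) of finite mass for ANY measure `νN` ⇒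
`∫⁻ (Σ'_q ‖f(γ_q·u·h)‖ₑ)·β(u) dνN(u) ≠ ∞` (★ G1-END summable majorant on the compact `K·h`). [cite: MoeglinWaldspurger1995, II.1.5] [cite: Garrett2018, §3.10] -/
theorem lintegral_tsum_enorm_mul_weight_ne_top (hdV0 : ∀ i, dV i ≠ 0) (hdW0 : ∀ i, dW i ≠ 0)
    {χ : HeckeCharacter L} (hχ : χ.IsUnitary) {s : ℂ} (hs : (n : ℝ) / 2 < s.re)
    {f : HA L e dV hdV dW hdW → ℂ} (hf : IsSiegelDeltaSection L e dV hdV dW hdW χ s f) (hfc : Continuous f)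
    (νN : Measure (unipDelta L e dV hdV dW hdW)) {β : unipDelta L e dV hdV dW hdW → ℝ≥0∞} (hβtop : ∫⁻ u, β u ∂νN ≠ ∞)
    {K : Set (unipDelta L e dV hdV dW hdW)} (hK : IsCompact K) (hβK : ∀ u, β u ≤ K.indicator 1 u) (h : HA L e dV hdV dW hdW) :
    ∫⁻ u, (∑' q : SiegelDeltaQuot L e dV hdV dW hdW,
        ‖f ((((Quotient.out q : ratH L e dV hdV dW hdW) : HA L e dV hdV dW hdW)) * ((u : HA L e dV hdV dW hdW) * h))‖ₑ) * β u ∂νN ≠ ∞ := by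
  -- the compact `K·h ⊆ H(𝔸)` and a summable majorant on it
  set K' : Set (HA L e dV hdV dW hdW) := (fun u : unipDelta L e dV hdV dW hdW => (u : HA L e dV hdV dW hdW) * h) '' K with hK'def
  have hK' : IsCompact K' := hK.image (continuous_subtype_val.mul continuous_const)
  obtain ⟨u₀, hu₀, hb⟩ := exists_summable_majorant_on_compact' L e dV hdV hdV0 dW hdW hdW0 hχ hs hf hfc hK'
  -- the bound `C := Σ' |u₀ q|` (as an extended real)
  set C : ℝ≥0∞ := ENNReal.ofReal (∑' q, |u₀ q|) with hC
  have hbound : ∀ u : unipDelta L e dV hdV dW hdW, u ∈ K →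
      (∑' q : SiegelDeltaQuot L e dV hdV dW hdW,
        ‖f ((((Quotient.out q : ratH L e dV hdV dW hdW) : HA L e dV hdV dW hdW)) * ((u : HA L e dV hdV dW hdW) * h))‖ₑ) ≤ C := by
    intro u hu
    have hx : ((u : HA L e dV hdV dW hdW) * h) ∈ K' := ⟨u, hu, rfl⟩
    calc (∑' q : SiegelDeltaQuot L e dV hdV dW hdW, ‖f ((((Quotient.out q : ratH L e dV hdV dW hdW) : HA L e dV hdV dW hdW)) * ((u : HA L e dV hdV dW hdW) * h))‖ₑ)
        ≤ ∑' q : SiegelDeltaQuot L e dV hdV dW hdW, ENNReal.ofReal |u₀ q| := by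
          refine ENNReal.tsum_le_tsum fun q => ?_
          rw [← ofReal_norm]
          exact ENNReal.ofReal_le_ofReal ((hb _ hx q).trans (le_abs_self _))
      _ = C := (ENNReal.ofReal_tsum_of_nonneg (fun q => abs_nonneg _) hu₀.abs).symm
  -- pointwise: integrand ≤ C·β (off `K` the weight vanishes)
  have hpt : ∀ u : unipDelta L e dV hdV dW hdW,
      (∑' q : SiegelDeltaQuot L e dV hdV dW hdW,
        ‖f ((((Quotient.out q : ratH L e dV hdV dW hdW) : HA L e dV hdV dW hdW)) * ((u : HA L e dV hdV dW hdW) * h))‖ₑ) * β u ≤ C * β u := by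
    intro u
    by_cases hu : u ∈ K
    · exact mul_le_mul_left (hbound u hu) _
    · have hβ0 : β u = 0 := le_antisymm ((hβK u).trans (by rw [Set.indicator_of_notMem hu])) bot_le
      rw [hβ0, mul_zero, mul_zero]
  refine ne_top_of_le_ne_top ?_ (lintegral_mono hpt)
  rw [lintegral_const_mul' _ _ ENNReal.ofReal_ne_top]
  exact ENNReal.mul_ne_top ENNReal.ofReal_ne_top hβtop

end Finiteness

/-! ## §2 The KIND-0 package in the payers' currency -/

section Package

/-- **rescaling a term package by a constant** keeps the four clauses: `c • E` is holomorphic, continuous, equals `(∏(s−p))·(c • T)` where `E = (∏(s−p))·T`, and grows like `E`.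
[cite: MoeglinWaldspurger1995, IV.1.8] -/
theorem smul_package {X : Type*} [TopologicalSpace X] (hgt : X → ℝ) (c : ℝ) (P : Finset ℂ) {a : ℝ} (T E : ℂ → X → ℂ)
    (hd : ∀ x, DifferentiableOn ℂ (fun s => E s x) {s : ℂ | 0 < s.re}) (hc : ∀ s : ℂ, 0 < s.re → Continuous (E s))
    (heq : ∀ (s : ℂ) (x : X), a < s.re → E s x = (∏ p ∈ P, (s - p)) * T s x)
    (hg : ∀ z : ℂ, 0 < z.re → ∃ C A r : ℝ, 0 < r ∧ ∀ s : ℂ, dist s z < r → ∀ x, ‖E s x‖ ≤ C * hgt x ^ A) :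
    (∀ x, DifferentiableOn ℂ (fun s => c • E s x) {s : ℂ | 0 < s.re}) ∧ (∀ s : ℂ, 0 < s.re → Continuous fun x => c • E s x) ∧
      (∀ (s : ℂ) (x : X), a < s.re → c • E s x = (∏ p ∈ P, (s - p)) * (c • T s x)) ∧
      (∀ z : ℂ, 0 < z.re → ∃ C A r : ℝ, 0 < r ∧ ∀ s : ℂ, dist s z < r → ∀ x, ‖c • E s x‖ ≤ C * hgt x ^ A) := by
  refine ⟨fun x => (hd x).const_smul c, fun s hs => (hc s hs).const_smul c, fun s x hs => ?_, fun z hz => ?_⟩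
  · rw [heq s x hs, mul_smul_comm]
  · obtain ⟨C, A, r, hr, hle⟩ := hg z hz
    refine ⟨‖c‖ * C, A, r, hr, fun s hs x => ?_⟩
    rw [norm_smul, mul_assoc]
    exact mul_le_mul_of_nonneg_left (hle s hs x) (norm_nonneg _)

/-- **EDITION 4a′ — THE KIND-0 PACKAGE FROM THE CELLS, PAYERS' CURRENCY, FINITENESS DISCHARGED.**  Carrier: `νN` left-invariant, `β` a covering weight with `β ≤ 𝟙_K` (`K` compact) and
`0 < ∫β < ∞` (the tie's carrier); `χ` UNITARY; `f_s ∈ I_Δ(s,χ)` continuous, holomorphic in `s` on `{0 < re}`, with the growth letter `hfgr`; the big-cell package `E₈` with (iv)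
`E₈ s h = (∏_{p∈P}(s−p))·intertwiningDelta νN (f s) h` (K2Liu-p13's `exists_bigCell_termPackage` shape) and the middle package `E₇` with (iv) `E₇ s h = (∏(s−p))·∫ β(u)•Σ_{q∈REST} f_s(γ_q(uh)) dνN`,
both with (i)(ii)(v).  THEN `∃ Ec₀` with the five KIND-0 binders of ★ `siegelEisensteinContinuation_of_kinds_fixedCarrier` (O41.4's `hH` by §1; ★ ed. 4a on the rescaled packages).
[cite: Tan1999, §4 Prop. 4.1] [cite: MoeglinWaldspurger1995, II.1.7, IV.1.8–IV.1.9] [cite: KudlaRallis1994, §1] -/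
theorem exists_constantTerm_package_of_cells (hdV0 : ∀ i, dV i ≠ 0) (hdW0 : ∀ i, dW i ≠ 0) (hn : 0 < n)
    (νN : Measure (unipDelta L e dV hdV dW hdW)) [νN.IsMulLeftInvariant]
    {β : unipDelta L e dV hdV dW hdW → ℝ≥0∞} (hβ : IsCoveringWeight (unipDeltaRat L e dV hdV dW hdW) β)
    (hβ0 : ∫⁻ u, β u ∂νN ≠ 0) (hβtop : ∫⁻ u, β u ∂νN ≠ ∞)
    {K : Set (unipDelta L e dV hdV dW hdW)} (hK : IsCompact K) (hβK : ∀ u, β u ≤ K.indicator 1 u)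
    (wq : unipDeltaRat L e dV hdV dW hdW → ratH L e dV hdV dW hdW)
    (hwq : ∀ ν, ((wq ν : ratH L e dV hdV dW hdW) : HA L e dV hdV dW hdW) = weylDelta L e dV hdV dW hdW * ((ν : unipDelta L e dV hdV dW hdW) : HA L e dV hdV dW hdW))
    {χ : HeckeCharacter L} (hχ : χ.IsUnitary) (f : ℂ → HA L e dV hdV dW hdW → ℂ) (hf : ∀ s, IsSiegelDeltaSection L e dV hdV dW hdW χ s (f s))
    (hfc : ∀ s, Continuous (f s)) (hfd : ∀ h : HA L e dV hdV dW hdW, DifferentiableOn ℂ (fun s => f s h) {s : ℂ | 0 < s.re})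
    (hfgr : ∀ z : ℂ, 0 < z.re → ∃ C A r : ℝ, 0 < r ∧ ∀ s : ℂ, dist s z < r → ∀ h : HA L e dV hdV dW hdW,
      ‖f s h‖ ≤ C * adelicHeightGL (n + n) L (h : GL (Fin (n + n)) (AdeleRing (𝓞 L) L)) ^ A)
    (P : Finset ℂ)
    (E₈ : ℂ → HA L e dV hdV dW hdW → ℂ) (h8d : ∀ h : HA L e dV hdV dW hdW, DifferentiableOn ℂ (fun s => E₈ s h) {s : ℂ | 0 < s.re})
    (h8c : ∀ s : ℂ, 0 < s.re → Continuous (E₈ s))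
    (h8eq : ∀ (s : ℂ) (h : HA L e dV hdV dW hdW), (n : ℝ) / 2 < s.re → E₈ s h = (∏ p ∈ P, (s - p)) * intertwiningDelta L e dV hdV dW hdW νN (f s) h)
    (h8g : ∀ z : ℂ, 0 < z.re → ∃ C A r : ℝ, 0 < r ∧ ∀ s : ℂ, dist s z < r → ∀ h : HA L e dV hdV dW hdW,
      ‖E₈ s h‖ ≤ C * adelicHeightGL (n + n) L (h : GL (Fin (n + n)) (AdeleRing (𝓞 L) L)) ^ A)
    (E₇ : ℂ → HA L e dV hdV dW hdW → ℂ) (h7d : ∀ h : HA L e dV hdV dW hdW, DifferentiableOn ℂ (fun s => E₇ s h) {s : ℂ | 0 < s.re})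
    (h7c : ∀ s : ℂ, 0 < s.re → Continuous (E₇ s))
    (h7eq : ∀ (s : ℂ) (h : HA L e dV hdV dW hdW), (n : ℝ) / 2 < s.re →
      E₇ s h = (∏ p ∈ P, (s - p)) * ∫ u, (β u).toReal •
        (∑' q : ↥(({Quotient.mk (MulAction.orbitRel (siegelDeltaRat L e dV hdV dW hdW) (ratH L e dV hdV dW hdW)) 1} ∪
            Set.range (fun ν : unipDeltaRat L e dV hdV dW hdW =>
              (Quotient.mk (MulAction.orbitRel (siegelDeltaRat L e dV hdV dW hdW) (ratH L e dV hdV dW hdW)) (wq ν) :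
                SiegelDeltaQuot L e dV hdV dW hdW)))ᶜ : Set (SiegelDeltaQuot L e dV hdV dW hdW)),
          f s ((((Quotient.out (q : SiegelDeltaQuot L e dV hdV dW hdW) : ratH L e dV hdV dW hdW) : HA L e dV hdV dW hdW)) *
            ((u : HA L e dV hdV dW hdW) * h))) ∂νN)
    (h7g : ∀ z : ℂ, 0 < z.re → ∃ C A r : ℝ, 0 < r ∧ ∀ s : ℂ, dist s z < r → ∀ h : HA L e dV hdV dW hdW,
      ‖E₇ s h‖ ≤ C * adelicHeightGL (n + n) L (h : GL (Fin (n + n)) (AdeleRing (𝓞 L) L)) ^ A) :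
    ∃ Ec₀ : ℂ → HA L e dV hdV dW hdW → ℂ,
      (∀ h : HA L e dV hdV dW hdW, DifferentiableOn ℂ (fun s => Ec₀ s h) {s : ℂ | 0 < s.re}) ∧
      (∀ s : ℂ, 0 < s.re → Continuous (Ec₀ s)) ∧
      (∀ (s : ℂ) (h : HA L e dV hdV dW hdW), (n : ℝ) / 2 < s.re →
        Ec₀ s h = (∏ p ∈ P, (s - p)) * fourierCoeffDelta L e dV hdV dW hdW νN β 0 (eisensteinFamilyDelta L e dV hdV dW hdW f s) h) ∧
      (∀ z : ℂ, 0 < z.re → ∀ h₀ : HA L e dV hdV dW hdW, ∃ r > (0 : ℝ), ∃ V ∈ 𝓝 h₀, ∃ Mb : ℝ,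
        ∀ s : ℂ, dist s z < r → ∀ h ∈ V, ‖Ec₀ s h‖ ≤ Mb) ∧
      (∀ z : ℂ, 0 < z.re → ∃ C A r : ℝ, 0 < r ∧ ∀ s : ℂ, dist s z < r → ∀ h : HA L e dV hdV dW hdW,
        ‖Ec₀ s h‖ ≤ C * adelicHeightGL (n + n) L (h : GL (Fin (n + n)) (AdeleRing (𝓞 L) L)) ^ A) := by
  set c : ℝ := (∫⁻ u, β u ∂νN).toReal⁻¹ with hcdef
  -- rescale the two packages
  obtain ⟨h8d', h8c', h8eq', h8g'⟩ := smul_package (fun h : HA L e dV hdV dW hdW => adelicHeightGL (n + n) L (h : GL (Fin (n + n)) (AdeleRing (𝓞 L) L)))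
    c P _ E₈ h8d h8c h8eq h8g
  obtain ⟨h7d', h7c', h7eq', h7g'⟩ := smul_package (fun h : HA L e dV hdV dW hdW => adelicHeightGL (n + n) L (h : GL (Fin (n + n)) (AdeleRing (𝓞 L) L)))
    c P _ E₇ h7d h7c h7eq h7g
  exact exists_constantTerm_package L e dV hdV dW hdW hn νN hβ hβ0 hβtop wq hwq f hf hfc hfd hfgr
    (fun s h hs => lintegral_tsum_enorm_mul_weight_ne_top L e dV hdV dW hdW hdV0 hdW0 hχ hs (hf s) (hfc s) νN hβtop hK hβK h)
    P (fun s h => c • E₈ s h) h8d' h8c' h8eq' h8g' (fun s h => c • E₇ s h) h7d' h7c' h7eq' h7g'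

end Package

end Summit.HodgeConjecture.HodgeConjecture.Cruxes.HLiu418.K2LiuSiegelEisensteinConstantTermFiniteness

end
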